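import Mathlib
import Summits.Ventures.FusionMHD.Bench.BallooningSAlphaEnclosureUnstable067
import Literature.MathematicalPhysics.MHD.BallooningSAlphaNewcombCriterion
import HarnessLib

/-!
# F3 — `(s, α) = (1, 67/100)` is OFF THE STABLE SIDE of the `s–α` model BY ENCLOSURE ALONE: the kernel-certified sign change
# `X₀(5) > 0 > X₀(7)` of the even solution (`BallooningSAlphaEnclosureUnstable067.lean`, lit-3 g13) fed to the Newcomb-criterion socket
# `not_stableSide_of_signChange` (`Literature/…/BallooningSAlphaNewcombCriterion.lean`, lit-3 g15) gives `¬ StableSide 1 (67/100)`,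
# hence a ONE-PIECE `C¹` instability witness — the upgrade of g13's piecewise (Hartman class `A₁`) conclusion `unstable_067`
(venture LADDER-GRIDFUSION, rung F3; cell `gridfusion`, typed by gridfusion-lit-3 (g15), 2026-08-28.  Composition file: 0 `def … : Prop` facts,
0 kit jobs, no `decide`, no `native_decide`; every certified number is imported BY NAME from the g13 file.)

## The statement (three columns, never merged)
CERTIFIED (kernel, this file): for the `s–α` MODEL of `Literature/MathematicalPhysics/MHD/BallooningSAlpha.lean` (Freidberg 2014 §12.6.2
(12.97), `θ₀ = 0`) at `s = 1`, `α = 67/100`: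
* ★★ `not_stableSide_067 : ¬ StableSide 1 (67/100)` — from `SAlphaU067.exists_solution` (the even solution in clock form exists on
  `[0, 15/2]`), `X_five_pos`, `X_seven_neg` (the certified boxes) and the socket `not_stableSide_of_signChange` (NO `P ≠ 0` box and no
  `δ`-room are consumed any more: uniqueness of the global even solution and the intermediate value theorem replace them);
* ★ `exists_unstableWitness_067` — hence SOME window carries a one-piece differentiable trial function vanishing at its ends with NEGATIVE
  `s–α` energy (lit-3's `UnstableWitness`), by `not_stableSide_iff_exists_unstableWitness`; an explicit one is the splice of the even
  solution with a tangent parabola (`exists_unstableWitness_of_two_zeros`).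
VALIDATED (juxtaposed): the same point is certified unstable by ★ #192's explicit polynomial witness; float first zero of `X₀` at
`θ ≈ 5.60`; Fig. 12.5.  MODELLED: the `s–α` model, one-surface Newcomb sense (`StableSide`), `θ₀ = 0`; no device.

## Sources
* J. P. Freidberg, *Ideal MHD*, CUP 2014 [Freidberg2014] §12.3 after (12.40) («If `X` has a zero crossing anywhere in the interval
  the plasma is unstable»), §12.6.2 eq. (12.97) — via the imports.
* P. Hartman, *ODE*, SIAM 2002 [Hartman2002] Ch. XI §6 Thm. 6.2 / Exercise 6.3 — via `BallooningSAlphaNewcombCriterion.lean`.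
* R. E. Moore, *Methods and Applications of Interval Analysis*, SIAM 1979 [Moore1979] §8.1 (8.13) — via the g13 enclosure file.
-/

noncomputable section

open Real Set
open Literature.MathematicalPhysics.MHD.Ballooning Literature.MathematicalPhysics.MHD.Ballooning.SAlpha

namespace Summit.Ventures.FusionMHD.Bench.SAlphaU067

/-- The clock component of a solution of the clock system from `(0, 1, 0)` IS the time: `y t 0 = t` on `[0, 15/2]`.
[cite: Freidberg2014, §12.6.2 eq. (12.97)] (autonomous first-order form of lit-3's `clockField`) -/
theorem clock_eq {y : ℝ → Fin 3 → ℝ} (hy0 : y 0 = ![0, 1, 0])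
    (hy : ∀ t ∈ Icc (0 : ℝ) (15 / 2), HasDerivWithinAt y (clockField 1 (67/100) (y t)) (Icc (0 : ℝ) (15 / 2)) t) :
    ∀ t ∈ Icc (0 : ℝ) (15 / 2), y t 0 = t := by
  have hθ : ∀ t ∈ Icc (0 : ℝ) (15 / 2), HasDerivWithinAt (fun t => y t 0) 1 (Icc (0 : ℝ) (15 / 2)) t := by
    intro t ht
    simpa [clockField] using (hasDerivWithinAt_pi.1 (hy t ht)) 0
  have hcont : ContinuousOn (fun t => y t 0 - t) (Icc (0 : ℝ) (15 / 2)) := fun t ht =>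
    ((hθ t ht).continuousWithinAt).sub continuousWithinAt_id
  have hder : ∀ t ∈ Ico (0 : ℝ) (15 / 2), HasDerivWithinAt (fun t => y t 0 - t) 0 (Ici t) t := by
    intro t ht
    have h1 : HasDerivWithinAt (fun t => y t 0) 1 (Ici t) t :=
      (hθ t ⟨ht.1, ht.2.le⟩).mono_of_mem_nhdsWithin (Icc_mem_nhdsGE_of_mem ht)
    have h2 := h1.sub (hasDerivWithinAt_id t (Ici t))
    rwa [sub_self] at h2
  intro t ht
  have := constant_of_has_deriv_right_zero hcont hder t ht
  have h00 : y 0 0 = 0 := by simp [hy0]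
  simp only [h00, sub_zero] at this
  linarith

/-- ★★ **`(1, 67/100)` IS OFF THE STABLE SIDE OF THE `s–α` MODEL — BY ENCLOSURE ALONE.**  The certified sign change `X₀(5) > 0 > X₀(7)`
of the even solution (`X_five_pos`, `X_seven_neg` of the g13 enclosure) through the Newcomb-criterion socket: NO window of the model at
`(1, 67/100)` is free of a one-piece differentiable trial function with negative energy — `¬ StableSide 1 (67/100)`.
[cite: Freidberg2014, §12.3 after eq. (12.40)] («zero crossing ⇒ unstable») with [Hartman2002] Ch. XI §6 Thm. 6.2 / Exercise 6.3;
enclosure [cite: Moore1979, §8.1 eq. (8.13)] -/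
theorem not_stableSide_067 : ¬ StableSide 1 (67/100) := by
  obtain ⟨y, hy0, hy⟩ := exists_solution
  have hcomp : ∀ t ∈ Icc (0 : ℝ) (15 / 2), ∀ i,
      HasDerivWithinAt (fun t => y t i) (clockField 1 (67/100) (y t) i) (Icc (0 : ℝ) (15 / 2)) t :=
    fun t ht i => (hasDerivWithinAt_pi.1 (hy t ht)) i
  have hclock := clock_eq hy0 hy
  have hX : ∀ t ∈ Icc (0 : ℝ) (15 / 2),
      HasDerivWithinAt (fun t => y t 1) ((fun t => y t 2) t / bending 1 (67/100) t) (Icc (0 : ℝ) (15 / 2)) t := by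
    intro t ht; have := hcomp t ht 1; simp [clockField] at this; rwa [hclock t ht] at this
  have hP : ∀ t ∈ Icc (0 : ℝ) (15 / 2),
      HasDerivWithinAt (fun t => y t 2) (-(drive 1 (67/100) t * (fun t => y t 1) t)) (Icc (0 : ℝ) (15 / 2)) t := by
    intro t ht; have := hcomp t ht 2; simp [clockField] at this; rwa [hclock t ht] at this
  have hP0 : (fun t => y t 2) 0 = 0 := by simp [hy0]
  exact not_stableSide_of_signChange (s := 1) (α := 67/100) (T' := 15 / 2) (t₁ := 5) (t₂ := 7) (by norm_num) hX hP hP0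
    ⟨by norm_num, by norm_num⟩ ⟨by norm_num, by norm_num⟩ (X_five_pos hy0 hy) (X_seven_neg hy0 hy)

/-- ★ … HENCE SOME WINDOW CARRIES A ONE-PIECE `C¹` INSTABILITY WITNESS at `(1, 67/100)` (lit-3's `UnstableWitness`: differentiable on the
closed window, zero at its ends, negative energy) — the enclosure route now lands in the same class as ★ #192's explicit witness.
[cite: Freidberg2014, §12.3 eqs. (12.38)–(12.40)] -/
theorem exists_unstableWitness_067 : ∃ (a b : ℝ) (X X' : ℝ → ℝ), UnstableWitness 1 (67/100) a b X X' :=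
  (not_stableSide_iff_exists_unstableWitness 1 (67/100)).1 not_stableSide_067

end Summit.Ventures.FusionMHD.Bench.SAlphaU067

end
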